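import Summits.HodgeConjecture.CorCM.Geometry.Facts
import Summits.HodgeConjecture.CorCM.Model.Universe
import Summits.HodgeConjecture.CorCM.KunnethDegreeOne
import Summits.HodgeConjecture.CorCM.RationalExteriorSpan
import Summits.HodgeConjecture.CorCM.WeilLineRank
import HarnessLib

/-!
# COR-CM — model rows M15 `kunneth1`, M16 `H4_span`, M17 `weilLine_rank` of BINDER-OWNERS.md for the
# Picard–CM model universe `Model.universeOf` (exterior-algebra / Künneth group)

HONEST FRAMING (cell pub-hodgecm2 / COR-CM, stage 2 of the Hodge ladder): these are STRUCTURAL facts about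
the Betti cohomology of the model universe's varieties (products of smooth projective complex varieties,
CM abelian varieties); no case of the Hodge conjecture is proved and nothing about algebraic cycles is
asserted. They discharge three of the `ModelAxioms` fields (`HodgeCM/Geometry/Facts.lean` of the stage-1
package, ported as `CorCM/Geometry/Facts.lean`) READ by the COR-CM end state, for the model of record
`U₀ = Model.universeOf hHD hI hU h₃` (`CorCM/Model/Universe.lean`; `Model.picardCMUniverse` is its
specialisation):

* `universeOf_fact_kunneth1 : U₀.Fact_kunneth1` — Künneth in degree one for every pair of varieties of the
  universe, from the scheme-level theorem `kunneth_one_bijective` (`CorCM/KunnethDegreeOne.lean`);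
* `universeOf_fact_H4_span : U₀.Fact_H4_span` — `H⁴` of the corner product is spanned over `ℚ` by four-fold
  cup products of degree-one classes, from `span_quadCup_eq_top_prod4` (`CorCM/RationalExteriorSpan.lean`);
  the corner product's scheme IS the underlying variety of the product abelian variety of the four chosen
  realisations (`AbelianVariety.prod_X`, definitional);
* `universeOf_fact_weilLine_rank_of : U₀.Fact_eigenLine → U₀.Fact_H1_rank → U₀.Fact_weilLine_rank` —
  the Weil line of the corner product has `ℚ`-dimension `[K:ℚ]`, from `finrank_weilLine_eq`
  (`CorCM/WeilLineRank.lean`) fed by the two `H¹`-facts of the model (rows M13 `eigenLine`, M07 `H1_rank`,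
  owned by the model seats; in the stage-1 package they are the kernel theorems `universeOf_fact_eigenLine`,
  `universeOf_fact_H1_rank` of `HodgeCM/Model/UniverseCM.lean`).

All three are definitional unfoldings of the model's fields (`universeOf_pull`, `universeOf_cup`,
`universeOf_cmAV`, `universeOf_cmAct`, `Var.scheme`, `Var.fst/snd`: `rfl`) followed by the scheme-level
theorems.
-/

noncomputable section

open scoped TensorProduct
open CategoryTheory MonoidalCategory
open Literature.AlgebraicGeometry.Motives Literature.AlgebraicGeometry.HodgeTheory
open Literature.NumberTheory.Automorphic.PicardCM

namespace Summit.HodgeConjecture.CorCM.Model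

variable (hHD : exists_isReal_hodgeModel) (hI : hodgePQ_independent_of_hodgeModel)
variable (hU : Literature.NumberTheory.Automorphic.PicardCM.BallQuotientUniformisedDatum)
  (h₃ : Literature.NumberTheory.Automorphic.PicardCM.CMAbelianVarietyRealised)

/-- **Row M15 (`kunneth1`, package M21) for the model universe**: Künneth in degree one,
`H¹(X × Y, ℚ) = fst^* H¹(X, ℚ) ⊕ snd^* H¹(Y, ℚ)`, for all varieties `X, Y` of `Model.universeOf`
(every one is smooth projective, `Var.isSmoothProjective`). [folklore] -/
theorem universeOf_fact_kunneth1 : (universeOf hHD hI hU h₃).Fact_kunneth1 := fun X Y ↦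
  kunneth_one_bijective (Var.isSmoothProjective hU h₃ X) (Var.isSmoothProjective hU h₃ Y)

/-- **Row M16 (`H4_span`, package M23) for the model universe**: `H⁴(P, ℚ)` of the corner product
`P = ((A_{Φ₀} × A_{Φ₁}) × A_{Φ₂}) × A_{Φ₃}` is spanned by the classes `(a ∪ b) ∪ (c ∪ d)`, `a, …, d ∈ H¹(P, ℚ)`.
[folklore] -/
theorem universeOf_fact_H4_span : (universeOf hHD hI hU h₃).Fact_H4_span := fun K Φ ↦
  span_quadCup_eq_top_prod4 (cmRealisation h₃ (cmCode K (Φ 0))).AV (cmRealisation h₃ (cmCode K (Φ 1))).AV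
    (cmRealisation h₃ (cmCode K (Φ 2))).AV (cmRealisation h₃ (cmCode K (Φ 3))).AV

/-- **Row M17 (`weilLine_rank`, package M15) for the model universe, from rows M13 and M07**: given that
every CM eigenline of the model is a line (`Fact_eigenLine`) and `dim_ℚ H¹(A_{(K,Φ)}, ℚ) = [K:ℚ]`
(`Fact_H1_rank`), the Weil line of every corner product has `ℚ`-dimension `[K:ℚ]`. [folklore] -/
theorem universeOf_fact_weilLine_rank_of (h12 : (universeOf hHD hI hU h₃).Fact_eigenLine)
    (h22 : (universeOf hHD hI hU h₃).Fact_H1_rank) :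
    (universeOf hHD hI hU h₃).Fact_weilLine_rank := fun K Φ ↦
  finrank_weilLine_eq (fun i ↦ (cmRealisation h₃ (cmCode K (Φ i))).AV)
    (fun i ↦ (cmActOf hHD hI hU h₃ (cmCode K (Φ i)) K (cmCodeEquiv K (Φ i))).ι)
    (fun i σ ↦ h12 K (Φ i) σ) (fun i ↦ h22 K (Φ i))

end Summit.HodgeConjecture.CorCM.Model

end
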